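import Summits.Ventures.DiscreteObjects.Hadamard.Order167InvertingNormalizer668
import Summits.Ventures.DiscreteObjects.Hadamard.Order167Centralizer668

/-!
# H(668): the block-preserving normaliser of an element of order 167 — `⟨σ⟩` itself, or the symmetric-circulant case (kernel)

Framing: lottery ticket; floor = certified bounds/negative ranges.

Cell pub-namedobj (venture DiscreteObjects), target (H), hadamard gen 20; one statement combining gen 19's centraliser theorem
(`Order167Centralizer668`: a block-preserving automorphism COMMUTING with `σ` is a power of `σ` at the pair level), gen 20's
`Order167Normalizer668` (every normalising automorphism acts as `±1`) and `Order167InvertingNormalizer668` (block-preserving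
inversion ⇔ symmetric circulant blocks).  **`hadamard668_order167_blockNormalizer_structure`**: for a Hadamard matrix of order `668`,
`σ = (π, κ, d, e)` with `π^167 = κ^167 = 1`, `(π,κ) ≠ 1`, and a signed automorphism `τ = (π', κ', d', e')` with `π'π = π^μ π'`,
`κ'κ = κ^μ κ'` mapping every row and every column into its own `σ`-orbit: EITHER `(π', κ') = (π^c, κ^c)` for some `c` (so `τ ∈ ±⟨σ⟩`),
OR `μ ≡ 166 (mod 167)` and some Hadamard matrix of order `668` is a `4 × 4` array of SYMMETRIC circulant `±1` blocks of order `167`.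
So the automorphisms of an H(668) that fix the block structure of an element of order `167` are exactly its powers (up to sign),
except possibly in the Williamson-like symmetric-16-circulant family, where the block reversal joins.  Structure of a hypothetical
object; no exclusion; H(668) untouched; HITS 0/4.  Ours; no `sorry`, no definitions.
-/

namespace Summit.Ventures.DiscreteObjects.Hadamard

open Finset BigOperators Matrix

open Literature.Combinatorics.Designs.GoethalsSeidel (IsHadamardMatrix)

variable {ι : Type*} [Fintype ι] [DecidableEq ι]

/-- **Block-preserving normalisers of an element of order 167: powers of `σ`, or the symmetric-circulant case.** -/
theorem hadamard668_order167_blockNormalizer_structure {H : Matrix ι ι ℤ} (hH : IsHadamardMatrix H)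
    (hι : Fintype.card ι = 668) {π κ π' κ' : Equiv.Perm ι} {d e d' e' : ι → ℤ} (haut : IsSignedAut H π κ d e)
    (hπ : π ^ 167 = 1) (hκ : κ ^ 167 = 1) (hne : π ≠ 1 ∨ κ ≠ 1) (haut' : IsSignedAut H π' κ' d' e')
    {μ : ℕ} (hnπ : π' * π = π ^ μ * π') (hnκ : κ' * κ = κ ^ μ * κ')
    (hrows : ∀ x, π' x ∈ orbFin π 167 x) (hcols : ∀ y, κ' y ∈ orbFin κ 167 y) :
    (∃ c : ℕ, π' = π ^ c ∧ κ' = κ ^ c) ∨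
    (μ % 167 = 166 ∧ ∃ x : Fin 4 → Fin 4 → ZMod 167 → ℤ,
      IsHadamardMatrix (Matrix.of fun (a b : Fin 4 × ZMod 167) => x a.1 b.1 (b.2 - a.2)) ∧ ∀ p q r, x p q (-r) = x p q r) := by
  obtain ⟨x₀⟩ : Nonempty ι := Fintype.card_pos_iff.mp (by rw [hι]; norm_num)
  -- μ ≡ ±1 (mod 167)
  have hsq := hadamard668_order167_normalizer_sq_eq_one hH hι haut hπ hκ hne haut' hnπ hnκ (hrows x₀) hcols
  have hcases : μ % 167 = 1 ∨ μ % 167 = 166 := by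
    haveI : Fact (Nat.Prime 167) := ⟨by norm_num⟩
    have h : ((μ : ZMod 167) - 1) * ((μ : ZMod 167) + 1) = 0 := by linear_combination hsq
    rcases mul_eq_zero.mp h with h1 | h1
    · left
      have : (μ : ZMod 167) = ((1 : ℕ) : ZMod 167) := by push_cast; linear_combination h1
      rw [ZMod.natCast_eq_natCast_iff'] at this
      simpa using this
    · right
      have : (μ : ZMod 167) = ((166 : ℕ) : ZMod 167) := by
        rw [zmod167_166]; linear_combination h1
      rw [ZMod.natCast_eq_natCast_iff'] at this
      simpa using this
  rcases hcases with h1 | h166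
  · -- μ ≡ 1: τ commutes with σ on both sides; gen 19's centraliser theorem
    left
    have hπμ : π ^ μ = π := by
      rw [← pow_mod_of_pow_eq_one π hπ μ, h1, pow_one]
    have hcomm : Commute π' π := by
      show π' * π = π * π'
      rw [hnπ, hπμ]
    have hpres : ∀ x, ∃ c : ℕ, π' x = (π ^ c) x := by
      intro x
      obtain ⟨c, -, hc⟩ := Finset.mem_image.mp (hrows x)
      exact ⟨c, hc.symm⟩
    exact hadamard668_order167_centralizer_rowOrbits hH hι haut hπ hκ hne haut' hcomm hpres
  · right
    obtain ⟨x, hx, -, hsym⟩ := exists_symmetricCirculantArray_of_inverting hH hι haut hπ hκ hne haut' hnπ hnκ h166 hrows hcols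
    exact ⟨h166, x, hx, hsym⟩

end Summit.Ventures.DiscreteObjects.Hadamard
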